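import Summits.BirchSwinnertonDyer.BirchSwinnertonDyer.Theorems.InertBadSignedBranchesCccOneLawOnTypeIstarZeroCollinearMu
import Summits.BirchSwinnertonDyer.Rank1Residual.Additive.KatoDescentRealizableContraRankOne
import Literature.NumberTheory.EllipticCurves.Kato2004.AdmissibleZetaClassUniformPositionProofs
import Literature.NumberTheory.EllipticCurves.Kato2004.AdmissibleZetaClassNonvanishingProofs
import Literature.NumberTheory.EllipticCurves.Kato2004.IwasawaH1ProjZeroKernelProofs
import Literature.NumberTheory.EllipticCurves.Kobayashi2003.EtaColemanPoitouTateSequences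
import Literature.NumberTheory.EllipticCurves.IwasawaAlgebraDivisibilityProofs
import HarnessLib

set_option linter.dupNamespace false
set_option autoImplicit false

/-!
# Route `InertBadSignedBranches` (rung K8), crux 19223 `CccOneLawOnTypeIstarZero`, line `kato_perrin_riou_istar`:
# the collinearity `μ`-dictionary IN STUB 2b's BINDERS — admissible classes (helper `--supports stmt-BirchSwinnertonDyer-19223`)

HONEST FRAMING (refill hand `leafhand-bsd-inertbadsignedbran-4`, LAND-ONLY): BSD is NOT proved by any of this; nothing
here closes a stub, an item or a cell; no definition, no new fact, no `sorry`; nothing is booked.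

WHAT.  Companion of `…CccOneLawOnTypeIstarZeroCollinearMu` (§1–§3: along `(C(p)^m F′) • z₀ = (C(p)^n G′) • z` in the
torsion-free `𝐇¹_Γ(T_pW)`, `m + length_(p) (𝐇¹_Γ ⧸ Λ∙z₀) = n + length_(p) (𝐇¹_Γ ⧸ Λ∙z)`).  Here the binders of RESEARCH
stub 2b `KatoPerrinRiouIstar.stub_katoMuEqualityIstarZero` are served from TREE THEOREMS:
* an admissible Kato zeta class (`Kato2004.IsAdmissibleZetaClass`) is `≠ 0` — `IsAdmissibleZetaClass.ne_zero_of_rohrlich` +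
  Rohrlich at every `p`-power conductor (`PSRohrlichAtLevel.rohrlich_primePow_of_isNewformOf`);
* the pin has `rank_Λ 𝐇¹_Γ = 1` from Mordell–Weil rank one and `Ш(W)[p^∞]` finite (`LocPKummer.rank_integralH1_le_one`,
  `IwasawaH1Data.rank_eq_one_of_rank_integralH1_le_one`) — on the rows of the crux these two follow from `r_an = 1` by GZK;
* `𝐇¹_Γ ⧸ Λ∙z` is torsion and `length_(p) (𝐇¹_Γ ⧸ Λ∙z) < ∞` for `z ≠ 0` (`IwasawaH1Data.module_finite_of_isCyclotomic`);
* the admissible side is `Λˣ`-RIGID: two admissible classes have the same `length_𝔮 (𝐇¹_Γ ⧸ Λ∙z₀)` at every `𝔮`, given a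
  uniform-position witness (`Kato2004.ZetaClassPosition`, unconditional form) or the named fact ★
  `Kato2004.exists_zetaClassPosition_of_rank_le_one` (Kato Thm. 12.5 (1) on the branch) — so stub 2b's `∀ admissible z₀` is an
  `∃` modulo ★;
* THE DICTIONARY: for an admissible `z₀`, any `z ≠ 0` (e.g. Kobayashi's `η`-class of hand -3's
  `Kobayashi2003.EtaColemanPoitouTateData`) a `μ`-reading exists, and for ANY reading «ZC-μ» ⟺ `m = n`.
So stub 2b's research residual is ONE integer equality `m = n`; NOT asserted here.

References: [Kato2004Asterisque] Thm. 12.4 (2), Thm. 12.5 (1) (p. 221), Conj. 12.10 (p. 224), §13.9 (p. 230), §14.9 (14.9.3)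
(p. 240); [RohrlichInventiones1984] Theorem (p. 409); [Washington1997] §13.2; [BurungaleTian2026] Rem. 2.7 (p. 5);
[Kobayashi2003] Thm. 6.3, proof of Thm. 7.4 (p. 13).
-/

noncomputable section

open scoped Classical

open Field Literature.NumberTheory.EllipticCurves Literature.NumberTheory.EllipticCurves.Module
  Literature.NumberTheory.EllipticCurves.IwasawaAlgebra Literature.NumberTheory.EllipticCurves.Kato2004

namespace Summit.BirchSwinnertonDyer.BirchSwinnertonDyer.Theorems.CccOneCollinearMu

/-! ## §4 The admissible side (stub 2b's binders): non-vanishing, rank one, finiteness, `Λˣ`-independence, the dictionary -/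

section Admissible

open Summit.BirchSwinnertonDyer.BirchSwinnertonDyer.Theorems.PSRohrlichAtLevel (rohrlich_primePow_of_isNewformOf)

variable {W : WeierstrassCurve ℚ} [W.IsElliptic] [W.IsGloballyMinimal] {p : ℕ} [Fact p.Prime]
  [ContinuousSMul ℤ_[p] (W.tateModule p)] {K : ZpExtension ℚ p} {hK : K.IsCyclotomic} {γ : absoluteGaloisGroup ℚ}
  (I : IwasawaH1Data W p K γ)

/-- **An admissible Kato zeta class is non-zero** — unconditionally, from the tree theorems
`IsAdmissibleZetaClass.ne_zero_of_rohrlich` (Kato's Thm. 12.5 (1) argument) and Rohrlich's generic non-vanishing at every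
`p`-power conductor (`PSRohrlichAtLevel.rohrlich_primePow_of_isNewformOf`). [cite: Kato2004Asterisque, Thm. 12.5 (1) and proof (pp. 221–222)]
[cite: RohrlichInventiones1984, Theorem (p. 409)] -/
theorem ne_zero_of_isAdmissibleZetaClass (hγ : K.IsTopGenerator γ) {z₀ : I.H}
    (h₀ : IsAdmissibleZetaClass W p K hK I z₀) : z₀ ≠ 0 := by
  haveI : Module.Free ℤ_[p] (W.tateModule p) := W.module_free_tateModule_holds p
  haveI : Module.Finite ℤ_[p] (W.tateModule p) := W.module_finite_tateModule_holds p
  exact h₀.ne_zero_of_rohrlich hγ (fun hf ↦ rohrlich_primePow_of_isNewformOf hf)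

/-- **`rank_Λ 𝐇¹_Γ(T_pW) = 1` on a pin carrying an admissible class**, from Mordell–Weil rank one and `Ш(W)[p^∞]` finite
(tree theorems `LocPKummer.rank_integralH1_le_one`, `IwasawaH1Data.rank_eq_one_of_rank_integralH1_le_one`; the lower bound
from `z₀ ≠ 0`). [cite: Kato2004Asterisque, Thm. 12.4 (2) (p. 221), §14.9 (14.9.3) (p. 240)] -/
theorem rank_eq_one_of_isAdmissibleZetaClass (hγ : K.IsTopGenerator γ) (hrk : W.mordellWeilRank = 1)
    (hsha : Finite (AddCommGroup.primaryComponent W.sha p)) {z₀ : I.H}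
    (h₀ : IsAdmissibleZetaClass W p K hK I z₀) : Module.rank (IwasawaAlgebra p) I.H = 1 := by
  haveI : Nontrivial I.H := nontrivial_of_ne z₀ 0 (ne_zero_of_isAdmissibleZetaClass I hγ h₀)
  exact I.rank_eq_one_of_rank_integralH1_le_one hK hγ
    (Summit.BirchSwinnertonDyer.Rank1Residual.Additive.LocPKummer.rank_integralH1_le_one W p K hrk hsha)

omit [W.IsGloballyMinimal] in
/-- **`𝐇¹_Γ ⧸ Λ∙z` is `Λ`-torsion** for `z ≠ 0` when `rank_Λ 𝐇¹_Γ = 1` (every element is collinear with `z`).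
[cite: Kato2004Asterisque, Thm. 12.4 (2) (p. 221)] -/
theorem isTorsion_quotient_span_of_rank_eq_one (hγ : K.IsTopGenerator γ)
    (hrank : Module.rank (IwasawaAlgebra p) I.H = 1) {z : I.H} (hz : z ≠ 0) :
    Module.IsTorsion (IwasawaAlgebra p) (I.H ⧸ (IwasawaAlgebra p) ∙ z) := by
  haveI := I.isTorsionFree hγ
  intro x
  obtain ⟨m, rfl⟩ := Submodule.Quotient.mk_surjective _ x
  obtain ⟨F, G, hFG, hprim⟩ :=
    Summit.BirchSwinnertonDyer.Rank1Residual.Additive.PerrinRiouUnit.exists_primitive_collinear hrank m z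
  have hF : F ≠ 0 := by
    rcases hprim with hF0 | hG0
    · exact fun h => hF0 (by rw [h, map_zero])
    · intro hF
      have hG : G ≠ 0 := fun h => hG0 (by rw [h, map_zero])
      rw [hF, zero_smul] at hFG
      exact hG (smul_eq_zero_imp_of_ne_zero I hγ hz G hFG.symm)
  refine ⟨⟨F, mem_nonZeroDivisors_of_ne_zero hF⟩, ?_⟩
  change F • (Submodule.Quotient.mk m : I.H ⧸ (IwasawaAlgebra p) ∙ z) = 0
  rw [← Submodule.Quotient.mk_smul, Submodule.Quotient.mk_eq_zero, hFG]
  exact Submodule.smul_mem _ G (Submodule.mem_span_singleton_self z)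

omit [W.IsGloballyMinimal] in
/-- **Finiteness of `length_(p) (𝐇¹_Γ ⧸ Λ∙z)`** for `z ≠ 0`, `rank_Λ 𝐇¹_Γ = 1`, `K` cyclotomic: `𝐇¹_Γ` is finitely generated
(`IwasawaH1Data.module_finite_of_isCyclotomic`) and the quotient is torsion. [cite: Kato2004Asterisque, §12.2 (12.2.1) (p. 220), Thm. 12.4 (2) (p. 221)]
[cite: Washington1997, §13.2] -/
theorem lengthAt_quotient_span_ne_top (hKc : K.IsCyclotomic) (hγ : K.IsTopGenerator γ)
    (hrank : Module.rank (IwasawaAlgebra p) I.H = 1) {z : I.H} (hz : z ≠ 0)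
    (𝔮 : PrimeSpectrum (IwasawaAlgebra p)) (h𝔮 : 𝔮.asIdeal = augIdealP p) :
    lengthAt (IwasawaAlgebra p) (I.H ⧸ (IwasawaAlgebra p) ∙ z) 𝔮 ≠ ⊤ := by
  haveI : Module.Finite (IwasawaAlgebra p) I.H := IwasawaH1Data.module_finite_of_isCyclotomic hKc hγ I
  exact lengthAt_ne_top_of_isTorsion p (I.H ⧸ (IwasawaAlgebra p) ∙ z)
    (isTorsion_quotient_span_of_rank_eq_one I hγ hrank hz) 𝔮 h𝔮

/-- **`Λˣ`-independence of the admissible side, given a uniform-position witness** (`Kato2004.ZetaClassPosition`, the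
content of Kato's Thm. 12.5 (1) on the branch): any two admissible classes `z₀, z₀′` of the pin have
`length_𝔮 (𝐇¹_Γ ⧸ Λ∙z₀) = length_𝔮 (𝐇¹_Γ ⧸ Λ∙z₀′)` at EVERY prime `𝔮` (they differ by a unit,
`IsAdmissibleZetaClass.exists_units_smul_eq_of_zetaClassPosition`). [cite: Kato2004Asterisque, §13.9 (p. 230 l. 4–9), Thm. 12.5 (1) (p. 221)] -/
theorem lengthAt_quotient_span_eq_of_admissible_pair_of_zetaClassPosition (hγ : K.IsTopGenerator γ)
    {z₀ z₀' z₁ : I.H} {k : ℕ} (h₀ : IsAdmissibleZetaClass W p K hK I z₀) (h₀' : IsAdmissibleZetaClass W p K hK I z₀')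
    (h₁ : ZetaClassPosition W p K hK I k z₁) (𝔮 : PrimeSpectrum (IwasawaAlgebra p)) :
    lengthAt (IwasawaAlgebra p) (I.H ⧸ (IwasawaAlgebra p) ∙ z₀) 𝔮 =
      lengthAt (IwasawaAlgebra p) (I.H ⧸ (IwasawaAlgebra p) ∙ z₀') 𝔮 := by
  obtain ⟨w, hw⟩ := h₀.exists_units_smul_eq_of_zetaClassPosition hγ h₀' h₁
  exact (lengthAt_quotient_span_eq_of_eq_units_smul_H I hw 𝔮).symm

/-- **`Λˣ`-independence of the admissible side under the named fact ★ `exists_zetaClassPosition_of_rank_le_one`**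
(Kato Thm. 12.5 (1) / §13.9 on the rank-`≤ 1` branch) and `rank_Λ 𝐇¹_Γ ≤ 1`: the right-hand side
`length_𝔮 (𝐇¹_Γ ⧸ Λ∙z₀)` of stub 2b does NOT depend on the admissible class `z₀`. [cite: Kato2004Asterisque, §13.9 (p. 230 l. 4–9), Thm. 12.5 (1) (p. 221), Conj. 12.10 (p. 224)] -/
theorem lengthAt_quotient_span_eq_of_admissible_pair (h : exists_zetaClassPosition_of_rank_le_one)
    (hγ : K.IsTopGenerator γ) (hp : p ≠ 2) (hrank : Module.rank (IwasawaAlgebra p) I.H ≤ 1)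
    {z₀ z₀' : I.H} (h₀ : IsAdmissibleZetaClass W p K hK I z₀) (h₀' : IsAdmissibleZetaClass W p K hK I z₀')
    (𝔮 : PrimeSpectrum (IwasawaAlgebra p)) :
    lengthAt (IwasawaAlgebra p) (I.H ⧸ (IwasawaAlgebra p) ∙ z₀) 𝔮 =
      lengthAt (IwasawaAlgebra p) (I.H ⧸ (IwasawaAlgebra p) ∙ z₀') 𝔮 := by
  obtain ⟨w, hw⟩ := h.admissible_eq_units_smul hK hγ hp I hrank h₀ h₀'
  exact (lengthAt_quotient_span_eq_of_eq_units_smul_H I hw 𝔮).symm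

/-- **Stub 2b's universal quantifier collapses to an existential (modulo ★)**: if ONE admissible class `z₀` of the pin
has `length_𝔮 (𝐇¹_Γ ⧸ Λ∙z₀) = ℓ`, then EVERY admissible class does (`ℓ` is e.g. `length_𝔮 Y.X` of a fine-Selmer dual
datum, or `length_𝔮 (𝐇¹_Γ ⧸ Λ∙z)` at Kobayashi's class). [cite: Kato2004Asterisque, Conj. 12.10 (p. 224), §13.9 (p. 230 l. 4–9)]
[cite: BurungaleTian2026, Rem. 2.7 (p. 5)] -/
theorem forall_admissible_lengthAt_eq_of_exists (h : exists_zetaClassPosition_of_rank_le_one)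
    (hγ : K.IsTopGenerator γ) (hp : p ≠ 2) (hrank : Module.rank (IwasawaAlgebra p) I.H ≤ 1)
    (𝔮 : PrimeSpectrum (IwasawaAlgebra p)) {ℓ : ℕ∞}
    (hex : ∃ z₀ : I.H, IsAdmissibleZetaClass W p K hK I z₀ ∧
      lengthAt (IwasawaAlgebra p) (I.H ⧸ (IwasawaAlgebra p) ∙ z₀) 𝔮 = ℓ) :
    ∀ z₀' : I.H, IsAdmissibleZetaClass W p K hK I z₀' →
      lengthAt (IwasawaAlgebra p) (I.H ⧸ (IwasawaAlgebra p) ∙ z₀') 𝔮 = ℓ := by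
  obtain ⟨z₀, h₀, hℓ⟩ := hex
  intro z₀' h₀'
  rw [← hℓ]
  exact (lengthAt_quotient_span_eq_of_admissible_pair I h hγ hp hrank h₀ h₀' 𝔮).symm

/-- **The `μ`-reading of an admissible class against any non-zero class (e.g. Kobayashi's `η`-class) — existence.**
On a pin over a cyclotomic datum with Mordell–Weil rank one and `Ш(W)[p^∞]` finite, for an admissible `z₀` and any `z ≠ 0`
in `𝐇¹_Γ(T_pW)` there are `m n : ℕ`, `F′, G′ ∉ (p)` with `(C(p)^m F′) • z₀ = (C(p)^n G′) • z` and
`m + length_(p) (𝐇¹_Γ ⧸ Λ∙z₀) = n + length_(p) (𝐇¹_Γ ⧸ Λ∙z)`. All module-theoretic inputs are tree theorems.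
[cite: Kato2004Asterisque, Thm. 12.4 (2) (p. 221), Conj. 12.10 (p. 224)] [cite: Washington1997, §13.2] -/
theorem exists_mu_reading_of_isAdmissibleZetaClass (hγ : K.IsTopGenerator γ) (hrk : W.mordellWeilRank = 1)
    (hsha : Finite (AddCommGroup.primaryComponent W.sha p)) {z₀ z : I.H}
    (h₀ : IsAdmissibleZetaClass W p K hK I z₀) (hz : z ≠ 0)
    (𝔮 : PrimeSpectrum (IwasawaAlgebra p)) (h𝔮 : 𝔮.asIdeal = augIdealP p) :
    ∃ (m n : ℕ) (F' G' : IwasawaAlgebra p), F' ∉ augIdealP p ∧ G' ∉ augIdealP p ∧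
      (PowerSeries.C (p : ℤ_[p]) ^ m * F') • z₀ = (PowerSeries.C (p : ℤ_[p]) ^ n * G') • z ∧
      (m : ℕ∞) + lengthAt (IwasawaAlgebra p) (I.H ⧸ (IwasawaAlgebra p) ∙ z₀) 𝔮 =
        (n : ℕ∞) + lengthAt (IwasawaAlgebra p) (I.H ⧸ (IwasawaAlgebra p) ∙ z) 𝔮 :=
  exists_mu_reading I hγ (rank_eq_one_of_isAdmissibleZetaClass I hγ hrk hsha h₀)
    (ne_zero_of_isAdmissibleZetaClass I hγ h₀) hz 𝔮 h𝔮

/-- **«ZC-μ» ⟺ `m = n` for an admissible class against any non-zero class — the dictionary.**  On a pin over a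
cyclotomic datum with Mordell–Weil rank one and `Ш(W)[p^∞]` finite, for an admissible `z₀`, any `z ≠ 0` and ANY reading
`(C(p)^m F′) • z₀ = (C(p)^n G′) • z` with `F′, G′ ∉ (p)`:
`length_(p) (𝐇¹_Γ ⧸ Λ∙z₀) = length_(p) (𝐇¹_Γ ⧸ Λ∙z) ↔ m = n`.  With `z` Kobayashi's `η`-class (hand -3's
`Kobayashi2003.EtaColemanPoitouTateData.z`) the left side is the residual «ZC-μ» of stub 2b; so the stub's research content
is the single integer `m − n` (the `μ`-part of the «signed period ratio of an additive twist» of the crux's `why_might_fail`).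
NOT asserted to vanish here. [cite: Kato2004Asterisque, Thm. 12.4 (2) (p. 221), Conj. 12.10 (p. 224)]
[cite: BurungaleTian2026, Rem. 2.7 (p. 5)] [cite: Kobayashi2003, Thm. 6.3 (p. 11), proof of Thm. 7.4 (p. 13)] [cite: Washington1997, §13.2] -/
theorem lengthAt_quotient_span_eq_iff_of_isAdmissibleZetaClass (hγ : K.IsTopGenerator γ)
    (hrk : W.mordellWeilRank = 1) (hsha : Finite (AddCommGroup.primaryComponent W.sha p)) {z₀ z : I.H}
    (h₀ : IsAdmissibleZetaClass W p K hK I z₀) (hz : z ≠ 0) {m n : ℕ} {F' G' : IwasawaAlgebra p}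
    (hF' : F' ∉ augIdealP p) (hG' : G' ∉ augIdealP p)
    (h : (PowerSeries.C (p : ℤ_[p]) ^ m * F') • z₀ = (PowerSeries.C (p : ℤ_[p]) ^ n * G') • z)
    (𝔮 : PrimeSpectrum (IwasawaAlgebra p)) (h𝔮 : 𝔮.asIdeal = augIdealP p) :
    lengthAt (IwasawaAlgebra p) (I.H ⧸ (IwasawaAlgebra p) ∙ z₀) 𝔮 =
        lengthAt (IwasawaAlgebra p) (I.H ⧸ (IwasawaAlgebra p) ∙ z) 𝔮 ↔ m = n :=
  lengthAt_quotient_span_eq_iff_of_collinear I hγ (ne_zero_of_isAdmissibleZetaClass I hγ h₀) hz hF' hG' h 𝔮 h𝔮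
    (lengthAt_quotient_span_ne_top I hK hγ (rank_eq_one_of_isAdmissibleZetaClass I hγ hrk hsha h₀) hz 𝔮 h𝔮)

end Admissible

/-! ## §5 The Coleman-image form: «ZC-μ» through ANY injective `Λ`-linear functional (Kobayashi's `Col^± ∘ loc`) -/

section Functional

variable {R : Type*} [CommRing R] {H : Type*} [AddCommGroup H] [Module R H]

/-- **`length_𝔭 (R ⧸ (c z₀)) = length_𝔭 (H ⧸ R∙z₀) + length_𝔭 (R ⧸ range c)`** for an INJECTIVE linear functional
`c : H → R` and any `z₀ ∈ H` (the map `H → R ⧸ (c z₀)` has kernel `R∙z₀` and cokernel `R ⧸ range c`). [cite: Kato2004Asterisque, §17.13 (p. 280)]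
[cite: Kobayashi2003, proof of Thm. 7.4 (p. 13)] -/
theorem lengthAt_quotient_span_image_eq_add (c : H →ₗ[R] R) (hc : Function.Injective c) (z₀ : H)
    (𝔭 : PrimeSpectrum R) :
    lengthAt R (R ⧸ Ideal.span {c z₀}) 𝔭 =
      lengthAt R (H ⧸ R ∙ z₀) 𝔭 + lengthAt R (R ⧸ LinearMap.range c) 𝔭 := by
  set N : Submodule R R := Ideal.span {c z₀} with hN
  have hNle : N ≤ LinearMap.range c := by
    rw [hN, Ideal.span_singleton_le_iff_mem]; exact LinearMap.mem_range_self c z₀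
  let φ : H →ₗ[R] R ⧸ N := N.mkQ ∘ₗ c
  have hker : LinearMap.ker φ = R ∙ z₀ := by
    ext h
    rw [LinearMap.mem_ker, LinearMap.comp_apply, Submodule.mkQ_apply, Submodule.Quotient.mk_eq_zero, hN,
      Ideal.mem_span_singleton', Submodule.mem_span_singleton]
    constructor
    · rintro ⟨a, ha⟩
      exact ⟨a, hc (by rw [map_smul, smul_eq_mul, ha])⟩
    · rintro ⟨a, rfl⟩
      exact ⟨a, by rw [map_smul, smul_eq_mul]⟩
  have hrange : LinearMap.range φ = (LinearMap.range c).map N.mkQ := by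
    rw [LinearMap.range_comp]
  rw [lengthAt_eq_add_quotient (LinearMap.range φ) 𝔭,
    ← lengthAt_eq_of_linearEquiv φ.quotKerEquivRange 𝔭,
    lengthAt_eq_of_linearEquiv (Submodule.quotEquivOfEq _ _ hker) 𝔭,
    lengthAt_eq_of_linearEquiv (Submodule.quotEquivOfEq _ _ hrange) 𝔭,
    lengthAt_eq_of_linearEquiv (Submodule.quotientQuotientEquivQuotient N (LinearMap.range c) hNle) 𝔭]

/-- **Through an injective functional, «equal `length_𝔭 (H ⧸ R∙·)`» ⟺ «equal `length_𝔭 (R ⧸ (c ·))`»** when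
`length_𝔭 (R ⧸ range c)` is finite. [cite: Kobayashi2003, proof of Thm. 7.4 (p. 13)] [cite: Washington1997, §13.2] -/
theorem lengthAt_quotient_span_eq_iff_of_injective (c : H →ₗ[R] R) (hc : Function.Injective c) (z₀ z : H)
    (𝔭 : PrimeSpectrum R) (hfin : lengthAt R (R ⧸ LinearMap.range c) 𝔭 ≠ ⊤) :
    lengthAt R (H ⧸ R ∙ z₀) 𝔭 = lengthAt R (H ⧸ R ∙ z) 𝔭 ↔
      lengthAt R (R ⧸ Ideal.span {c z₀}) 𝔭 = lengthAt R (R ⧸ Ideal.span {c z}) 𝔭 := by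
  rw [lengthAt_quotient_span_image_eq_add c hc z₀ 𝔭, lengthAt_quotient_span_image_eq_add c hc z 𝔭]
  exact (WithTop.add_right_inj hfin).symm

/-- `length_𝔭 (R ⧸ range c) ≤ length_𝔭 (R ⧸ (c z₀))` (the latter surjects onto the former). [folklore] -/
theorem lengthAt_quotient_range_le (c : H →ₗ[R] R) (z₀ : H) (𝔭 : PrimeSpectrum R) :
    lengthAt R (R ⧸ LinearMap.range c) 𝔭 ≤ lengthAt R (R ⧸ Ideal.span {c z₀}) 𝔭 := by
  have hle : (Ideal.span {c z₀} : Submodule R R) ≤ LinearMap.range c := by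
    rw [Ideal.span_singleton_le_iff_mem]; exact LinearMap.mem_range_self c z₀
  refine lengthAt_le_of_surjective (Submodule.factor hle) ?_ 𝔭
  intro y
  obtain ⟨x, rfl⟩ := Submodule.Quotient.mk_surjective _ y
  exact ⟨Submodule.Quotient.mk x, rfl⟩

/-- Through an injective functional `c`, «`z₀ = u • z`» (hand -3's unit form ZC) ⟺ «`c z₀ = u · c z`» — with
`c = Col⁺ ∘ loc` and `z` Kobayashi's class: «Col⁺(loc z₀) = u · L_p⁺(V, η, X)», a UNIT ratio of power series. [cite: Kobayashi2003, Thm. 7.3 i) (p. 13)] -/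
theorem eq_smul_iff_apply_eq_mul (c : H →ₗ[R] R) (hc : Function.Injective c) (z₀ z : H) (u : R) :
    z₀ = u • z ↔ c z₀ = u * c z := by
  rw [← smul_eq_mul, ← map_smul]
  exact ⟨fun h => by rw [h], fun h => hc h⟩

end Functional

section Coleman

variable {W : WeierstrassCurve ℚ} [W.IsElliptic] {p : ℕ} [Fact p.Prime]
  [ContinuousSMul ℤ_[p] (W.tateModule p)] {K : ZpExtension ℚ p} {γ : absoluteGaloisGroup ℚ}
  (I : IwasawaH1Data W p K γ)

/-- **«ZC-μ» in Coleman-image form.**  For ANY injective `Λ`-linear `c : 𝐇¹_Γ(T_pW) → Λ` (e.g. Kobayashi's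
`Col⁺ ∘ loc` / `X⁻¹Col⁻ ∘ loc` of `Kobayashi2003.EtaColemanPoitouTateData`, injective by his Thm. 7.3 i)), any `z₀ ≠ 0` and
any `z`: `length_(p) (𝐇¹_Γ ⧸ Λ∙z₀) = length_(p) (𝐇¹_Γ ⧸ Λ∙z) ↔ length_(p) (Λ ⧸ (c z₀)) = length_(p) (Λ ⧸ (c z))` — i.e.
«ZC-μ at `(z₀, z)`» says the `μ`-INVARIANTS OF THE POWER SERIES `c z₀` and `c z` agree.  With `z₀` admissible and
`(c, z) = (P.colPlus, P.z)` for a Kobayashi package `P` (`P.colPlus P.z` is a plus function `L_p⁺(V, η, X)`): stub 2b's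
residual is «`μ(Col⁺(loc z₀)) = μ(L_p⁺(V, η, X))`», the `μ`-invariant of the plus-Coleman image of Kato's
`Ω_W`-normalised zeta class of the additive twist `W` against Kobayashi–Pollack's `L_p⁺` of the good twin `V` at `η`
— the «signed period ratio of an additive twist» of the crux, as ONE equality of natural numbers; NOT asserted here.
[cite: Kobayashi2003, Thm. 6.3 (p. 11), Thm. 7.3 i) and proof of Thm. 7.4 (p. 13)] [cite: Kato2004Asterisque, Thm. 12.5 (1) (p. 221), Conj. 12.10 (p. 224)]
[cite: BurungaleTian2026, Rem. 2.7 (p. 5)] [cite: Washington1997, §13.2] -/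
theorem lengthAt_quotient_span_eq_iff_lengthAt_image (hγ : K.IsTopGenerator γ)
    (c : I.H →ₗ[IwasawaAlgebra p] IwasawaAlgebra p) (hc : Function.Injective c) {z₀ : I.H} (hz₀ : z₀ ≠ 0)
    (z : I.H) (𝔮 : PrimeSpectrum (IwasawaAlgebra p)) (h𝔮 : 𝔮.asIdeal = augIdealP p) :
    lengthAt (IwasawaAlgebra p) (I.H ⧸ (IwasawaAlgebra p) ∙ z₀) 𝔮 =
        lengthAt (IwasawaAlgebra p) (I.H ⧸ (IwasawaAlgebra p) ∙ z) 𝔮 ↔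
      lengthAt (IwasawaAlgebra p) (IwasawaAlgebra p ⧸ Ideal.span {c z₀}) 𝔮 =
        lengthAt (IwasawaAlgebra p) (IwasawaAlgebra p ⧸ Ideal.span {c z}) 𝔮 := by
  have _ := hγ
  have hc0 : c z₀ ≠ 0 := fun h => hz₀ (hc (by rw [h, map_zero]))
  refine lengthAt_quotient_span_eq_iff_of_injective c hc z₀ z 𝔮 (ne_top_of_le_ne_top ?_ (lengthAt_quotient_range_le c z₀ 𝔮))
  exact lengthAt_quotient_span_ne_top_of_ne_zero hc0 𝔮 h𝔮

/-- **The `μ`-reading through the functional**: with `c z₀ = C(p)^m · F′`, `c z = C(p)^n · G′` (`F′, G′ ∉ (p)`; such readings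
exist for `z₀, z ≠ 0`, `exists_eq_C_pow_mul_not_mem`), «ZC-μ at `(z₀, z)`» ⟺ `m = n`. [cite: Kobayashi2003, proof of Thm. 7.4 (p. 13)]
[cite: Washington1997, §13.2] -/
theorem lengthAt_quotient_span_eq_iff_of_image_readings
    (c : I.H →ₗ[IwasawaAlgebra p] IwasawaAlgebra p) (hc : Function.Injective c) {z₀ z : I.H} (hz₀ : z₀ ≠ 0)
    {m n : ℕ} {F' G' : IwasawaAlgebra p} (hF' : F' ∉ augIdealP p) (hG' : G' ∉ augIdealP p)
    (hcz₀ : c z₀ = PowerSeries.C (p : ℤ_[p]) ^ m * F') (hcz : c z = PowerSeries.C (p : ℤ_[p]) ^ n * G')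
    (𝔮 : PrimeSpectrum (IwasawaAlgebra p)) (h𝔮 : 𝔮.asIdeal = augIdealP p) :
    lengthAt (IwasawaAlgebra p) (I.H ⧸ (IwasawaAlgebra p) ∙ z₀) 𝔮 =
        lengthAt (IwasawaAlgebra p) (I.H ⧸ (IwasawaAlgebra p) ∙ z) 𝔮 ↔ m = n := by
  have hc0 : c z₀ ≠ 0 := fun h => hz₀ (hc (by rw [h, map_zero]))
  rw [lengthAt_quotient_span_eq_iff_of_injective c hc z₀ z 𝔮
      (ne_top_of_le_ne_top (lengthAt_quotient_span_ne_top_of_ne_zero hc0 𝔮 h𝔮) (lengthAt_quotient_range_le c z₀ 𝔮)),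
    hcz₀, hcz, lengthAt_quotient_span_C_pow_mul_of_not_mem m hF' 𝔮 h𝔮,
    lengthAt_quotient_span_C_pow_mul_of_not_mem n hG' 𝔮 h𝔮]
  exact ENat.coe_inj

end Coleman

section Kobayashi

open CongruenceSubgroup

variable {p : ℕ} [Fact p.Prime] {K₀ : Type} [Field K₀] [NumberField K₀] [(galRange (K := ℚ) K₀).Normal]
  {η : absoluteGaloisGroup ℚ →* ℤˣ} {V : WeierstrassCurve ℚ} [V.IsElliptic] {N : ℕ} {f : CuspForm (Gamma0 N) 2}
  {ϖ : ℚ} {κ : ZpExtension ℚ p} {γ : absoluteGaloisGroup ℚ} {W : WeierstrassCurve ℚ} [W.IsElliptic]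
  [W.IsGloballyMinimal] [ContinuousSMul ℤ_[p] (W.tateModule p)] {I : IwasawaH1Data W p κ γ}
  {FB : W.FineSelmerDualData κ γ} {hκ : κ.IsCyclotomic}

/-- **Stub 2b's residual at Kobayashi's package, plus side.**  For a Kobayashi package `P` on the pin `I` (hand -3's
`Kobayashi2003.EtaColemanPoitouTateData`, the named fact `thm62_63_73_etaColemanPoitouTate`) and an ADMISSIBLE Kato class `z₀`
of `I`: «ZC-μ» `length_(p) (𝐇¹_Γ ⧸ Λ∙z₀) = length_(p) (𝐇¹_Γ ⧸ Λ∙P.z)` holds IFF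
`length_(p) (Λ ⧸ (P.colPlus z₀)) = length_(p) (Λ ⧸ (P.colPlus P.z))`, where `P.colPlus P.z` is a plus function
`L_p⁺(V, η, X)` (`P.isPlus_colPlus_z`): the `μ`-invariant of `Col⁺(loc z₀)` equals `μ(L_p⁺(V, η, X))`.  Kernel; NOT asserted.
[cite: Kobayashi2003, Thm. 6.3 (p. 11), Thm. 7.3 i) (p. 13)] [cite: Kato2004Asterisque, Conj. 12.10 (p. 224)] [cite: BurungaleTian2026, Rem. 2.7 (p. 5)] -/
theorem zcMu_iff_lengthAt_colPlus (P : Kobayashi2003.EtaColemanPoitouTateData p K₀ η V f ϖ κ γ W I FB)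
    (hγ : κ.IsTopGenerator γ) {z₀ : I.H} (h₀ : IsAdmissibleZetaClass W p κ hκ I z₀)
    (𝔮 : PrimeSpectrum (IwasawaAlgebra p)) (h𝔮 : 𝔮.asIdeal = augIdealP p) :
    lengthAt (IwasawaAlgebra p) (I.H ⧸ (IwasawaAlgebra p) ∙ z₀) 𝔮 =
        lengthAt (IwasawaAlgebra p) (I.H ⧸ (IwasawaAlgebra p) ∙ P.z) 𝔮 ↔
      lengthAt (IwasawaAlgebra p) (IwasawaAlgebra p ⧸ Ideal.span {P.colPlus z₀}) 𝔮 =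
        lengthAt (IwasawaAlgebra p) (IwasawaAlgebra p ⧸ Ideal.span {P.colPlus P.z}) 𝔮 :=
  lengthAt_quotient_span_eq_iff_lengthAt_image I hγ P.colPlus P.colPlus_injective
    (ne_zero_of_isAdmissibleZetaClass I hγ h₀) P.z 𝔮 h𝔮

/-- **Minus side** (the same residual read through `X⁻¹Col⁻ ∘ loc`, `P.colMinus`; `X · P.colMinus P.z` is a minus function
`L_p⁻(V, η, X)`): «ZC-μ» ⟺ `length_(p) (Λ ⧸ (P.colMinus z₀)) = length_(p) (Λ ⧸ (P.colMinus P.z))` — so the plus and minus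
readings of the admissible class have EQUAL `μ`-defects (a consistency constraint on the line). [cite: Kobayashi2003, Thm. 6.3 (p. 11), Thm. 7.3 i) (p. 13)]
[cite: Kato2004Asterisque, Conj. 12.10 (p. 224)] -/
theorem zcMu_iff_lengthAt_colMinus (P : Kobayashi2003.EtaColemanPoitouTateData p K₀ η V f ϖ κ γ W I FB)
    (hγ : κ.IsTopGenerator γ) {z₀ : I.H} (h₀ : IsAdmissibleZetaClass W p κ hκ I z₀)
    (𝔮 : PrimeSpectrum (IwasawaAlgebra p)) (h𝔮 : 𝔮.asIdeal = augIdealP p) :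
    lengthAt (IwasawaAlgebra p) (I.H ⧸ (IwasawaAlgebra p) ∙ z₀) 𝔮 =
        lengthAt (IwasawaAlgebra p) (I.H ⧸ (IwasawaAlgebra p) ∙ P.z) 𝔮 ↔
      lengthAt (IwasawaAlgebra p) (IwasawaAlgebra p ⧸ Ideal.span {P.colMinus z₀}) 𝔮 =
        lengthAt (IwasawaAlgebra p) (IwasawaAlgebra p ⧸ Ideal.span {P.colMinus P.z}) 𝔮 :=
  lengthAt_quotient_span_eq_iff_lengthAt_image I hγ P.colMinus P.colMinus_injective
    (ne_zero_of_isAdmissibleZetaClass I hγ h₀) P.z 𝔮 h𝔮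

/-- **Plus = minus consistency**: for an admissible `z₀` and a Kobayashi package `P`, the plus-side and minus-side
`μ`-comparisons are EQUIVALENT (`μ(Col⁺ z₀) = μ(Col⁺ P.z) ↔ μ(X⁻¹Col⁻ z₀) = μ(X⁻¹Col⁻ P.z)`), both being «ZC-μ».
[cite: Kobayashi2003, Thm. 6.3 (p. 11), Thm. 7.3 i) (p. 13)] -/
theorem lengthAt_colPlus_eq_iff_lengthAt_colMinus_eq (P : Kobayashi2003.EtaColemanPoitouTateData p K₀ η V f ϖ κ γ W I FB)
    (hγ : κ.IsTopGenerator γ) {z₀ : I.H} (h₀ : IsAdmissibleZetaClass W p κ hκ I z₀)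
    (𝔮 : PrimeSpectrum (IwasawaAlgebra p)) (h𝔮 : 𝔮.asIdeal = augIdealP p) :
    lengthAt (IwasawaAlgebra p) (IwasawaAlgebra p ⧸ Ideal.span {P.colPlus z₀}) 𝔮 =
        lengthAt (IwasawaAlgebra p) (IwasawaAlgebra p ⧸ Ideal.span {P.colPlus P.z}) 𝔮 ↔
      lengthAt (IwasawaAlgebra p) (IwasawaAlgebra p ⧸ Ideal.span {P.colMinus z₀}) 𝔮 =
        lengthAt (IwasawaAlgebra p) (IwasawaAlgebra p ⧸ Ideal.span {P.colMinus P.z}) 𝔮 := by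
  rw [← zcMu_iff_lengthAt_colPlus P hγ h₀ 𝔮 h𝔮, zcMu_iff_lengthAt_colMinus P hγ h₀ 𝔮 h𝔮]

end Kobayashi

end Summit.BirchSwinnertonDyer.BirchSwinnertonDyer.Theorems.CccOneCollinearMu

end
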